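import Literature.Analysis.Complex.KoebeDistortion
import Literature.Analysis.Complex.KoebeQuarterProofs
import Mathlib.Analysis.Complex.UpperHalfPlane.Topology
import HarnessLib

/-!
# A univalent map read at two nearby points: Koebe bounds in logarithmic form

Topic `Literature/Analysis/Complex` (univalent functions). For `f` holomorphic and injective on a
disc `B(c, R)` and a second point `w` with `‖w - c‖ ≤ ρR`, `ρ` small, the classical distortion
theorems (Ch. Pommerenke, *Boundary Behaviour of Conformal Maps* (1992), Thm. 1.3 (14)–(15) and
Cor. 1.4; in the tree `Literature.Analysis.Complex.AreaThm.distortion_ball` and Koebe's one-quarter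
theorem `koebeQuarter_holds`) are repackaged in the RELATIVE / LOGARITHMIC form in which they are
consumed when two conformal maps `f ∘ g₁`, `f ∘ g₂` with `g₁ ≈ g₂` are compared through the common
outer factor `f` (e.g. two Loewner chains whose driving functions agree after a short initial
time, `LoewnerLateAgreement.lean`):

* `ball_subset_image_ball` — Koebe 1/4 on a disc: `B(f(c), |f'(c)| R/4) ⊆ f(B(c, R))`;
* `norm_deriv_mul_le_four_mul_im` — if moreover `f(B(c, R)) ⊆ ℍ` then `|f'(c)| R/4 ≤ Im f(c)`
  (the real point `Re f(c)` is not a value);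
* `abs_log_norm_deriv_sub_le` — `|log |f'(w)| - log |f'(c)|| ≤ 7ρ` for `‖w - c‖ ≤ ρR`, `ρ ≤ 1/2`
  (logarithm of (15): `(1-ρ)/(1+ρ)³ ≤ |f'(w)/f'(c)| ≤ (1+ρ)/(1-ρ)³`);
* `norm_sub_le_four_mul` — `‖f(w) - f(c)‖ ≤ 4 |f'(c)| ‖w - c‖` for `‖w - c‖ ≤ R/2` ((14));
* for maps into `ℍ` and `ρ ≤ 1/32` (section `IntoUpperHalfPlane`): `‖f(w) - f(c)‖ ≤ 16ρ Im f(c)`,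
  `|log Im f(w) - log Im f(c)| ≤ 32ρ`, and, seen from any real base point `x`,
  `|Re Z_w/|Z_w| - Re Z_c/|Z_c|| ≤ 32ρ` for `Z_· = f(·) - x` (`abs_re_unit_sub_re_unit_le`):
  the height, the conformal radius and the direction of the image point move by `O(ρ)` in
  relative terms.

Elementary helpers: `log_one_sub_ge` (`-2x ≤ log(1-x)` on `[0, 1/2]`), `norm_unit_sub_unit_le`
(`‖a/|a| - b/|b|‖ ≤ 2‖a - b‖/‖b‖`).

## References

* Ch. Pommerenke, *Boundary Behaviour of Conformal Maps*, Springer (1992), §1.3, Thm. 1.3 and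
  Cor. 1.4 [PommerenkeBBCM1992].
-/

noncomputable section

open Set Filter Metric Complex
open _root_.Topology
open UpperHalfPlane (upperHalfPlaneSet)

namespace Literature.Analysis.Complex

variable {f : ℂ → ℂ} {c : ℂ} {R : ℝ}

/-! ### Elementary helpers -/

/-- `-2x ≤ log (1 - x)` for `0 ≤ x ≤ 1/2` (from `1 - 1/y ≤ log y` at `y = 1 - x`). [folklore] -/
theorem log_one_sub_ge {x : ℝ} (hx0 : 0 ≤ x) (hx : x ≤ 1 / 2) : -(2 * x) ≤ Real.log (1 - x) := by
  have h1 : 1 - (1 - x)⁻¹ ≤ Real.log (1 - x) := Real.one_sub_inv_le_log_of_pos (by linarith)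
  have h2 : (1 - x)⁻¹ ≤ 1 + 2 * x := by
    rw [inv_le_iff_one_le_mul₀ (by linarith)]
    nlinarith
  linarith

/-- **Unit vectors of nearby nonzero complex numbers**: `‖a/‖a‖ - b/‖b‖‖ ≤ 2 ‖a - b‖ / ‖b‖`.
[folklore] -/
theorem norm_unit_sub_unit_le {a b : ℂ} (ha : a ≠ 0) (hb : b ≠ 0) :
    ‖a / (‖a‖ : ℂ) - b / (‖b‖ : ℂ)‖ ≤ 2 * ‖a - b‖ / ‖b‖ := by
  have ha' : 0 < ‖a‖ := norm_pos_iff.2 ha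
  have hb' : 0 < ‖b‖ := norm_pos_iff.2 hb
  have ha'' : (‖a‖ : ℂ) ≠ 0 := by exact_mod_cast ha'.ne'
  have hb'' : (‖b‖ : ℂ) ≠ 0 := by exact_mod_cast hb'.ne'
  have hdecomp : a / (‖a‖ : ℂ) - b / (‖b‖ : ℂ) =
      (a - b) / (‖b‖ : ℂ) + a * ((‖b‖ : ℂ) - ‖a‖) / ((‖a‖ : ℂ) * ‖b‖) := by
    field_simp
    ring
  rw [hdecomp]
  have h1 : ‖(a - b) / (‖b‖ : ℂ)‖ = ‖a - b‖ / ‖b‖ := by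
    rw [norm_div, Complex.norm_real, Real.norm_eq_abs, abs_of_pos hb']
  have h2 : ‖a * ((‖b‖ : ℂ) - ‖a‖) / ((‖a‖ : ℂ) * ‖b‖)‖ ≤ ‖a - b‖ / ‖b‖ := by
    rw [norm_div, norm_mul, norm_mul, Complex.norm_real, Complex.norm_real, Real.norm_eq_abs,
      Real.norm_eq_abs, abs_of_pos ha', abs_of_pos hb', ← Complex.ofReal_sub, Complex.norm_real,
      Real.norm_eq_abs]
    rw [div_le_div_iff₀ (by positivity) hb']
    have h3 : |‖b‖ - ‖a‖| ≤ ‖a - b‖ := by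
      rw [abs_sub_comm]; exact abs_norm_sub_norm_le a b
    calc ‖a‖ * |‖b‖ - ‖a‖| * ‖b‖ = (|‖b‖ - ‖a‖|) * (‖a‖ * ‖b‖) := by ring
      _ ≤ ‖a - b‖ * (‖a‖ * ‖b‖) := by gcongr
  calc ‖(a - b) / (‖b‖ : ℂ) + a * ((‖b‖ : ℂ) - ‖a‖) / ((‖a‖ : ℂ) * ‖b‖)‖
      ≤ ‖(a - b) / (‖b‖ : ℂ)‖ + ‖a * ((‖b‖ : ℂ) - ‖a‖) / ((‖a‖ : ℂ) * ‖b‖)‖ := norm_add_le _ _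
    _ ≤ ‖a - b‖ / ‖b‖ + ‖a - b‖ / ‖b‖ := by rw [h1]; gcongr
    _ = 2 * ‖a - b‖ / ‖b‖ := by ring

/-- `Re Z/‖Z‖` is the real part of the unit vector `Z/‖Z‖` (also for `Z = 0`). [folklore] -/
theorem re_div_norm_eq_re_unit (Z : ℂ) : Z.re / ‖Z‖ = (Z / (‖Z‖ : ℂ)).re := by
  rw [Complex.div_ofReal_re]

/-! ### Koebe's one-quarter theorem and distortion on a disc, logarithmic form -/

/-- **Koebe's one-quarter theorem on a disc**: for `f` holomorphic and injective on `B(c, R)`,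
`B(f(c), |f'(c)| R/4) ⊆ f(B(c, R))` (Koebe's theorem for `ζ ↦ f(c + Rζ)` on the unit disc).
[cite: PommerenkeBBCM1992, Cor. 1.4] -/
theorem ball_subset_image_ball (hR : 0 < R) (hf : DifferentiableOn ℂ f (ball c R))
    (hinj : InjOn f (ball c R)) : ball (f c) (‖deriv f c‖ * R / 4) ⊆ f '' ball c R := by
  obtain ⟨hFd, hFinj, hFderiv⟩ := AreaThm.rescale_ball hR hf hinj
  have hK := koebeQuarter_holds _ hFd hFinj
  have hFd0 : deriv (fun ζ : ℂ ↦ f (c + R * ζ)) 0 = R * deriv f c := by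
    rw [hFderiv 0 (mem_ball_self one_pos)]; simp
  simp only [mul_zero, add_zero] at hK
  rw [hFd0, norm_mul, Complex.norm_real, Real.norm_eq_abs, abs_of_pos hR] at hK
  intro w hw
  have hw' : w ∈ ball (f c) (R * ‖deriv f c‖ / 4) := by
    rw [mem_ball] at hw ⊢
    rwa [mul_comm R]
  obtain ⟨ζ', hζ', rfl⟩ := hK hw'
  refine ⟨c + R * ζ', ?_, rfl⟩
  rw [mem_ball_zero_iff] at hζ'
  rw [mem_ball, dist_eq_norm, add_sub_cancel_left, norm_mul, Complex.norm_real, Real.norm_eq_abs,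
    abs_of_pos hR]
  calc R * ‖ζ'‖ < R * 1 := by gcongr
    _ = R := mul_one R

/-- **A univalent map of a disc into `ℍ` has `|f'(c)| R/4 ≤ Im f(c)`**: otherwise the real point
`Re f(c)` would lie in the Koebe disc `B(f(c), |f'(c)| R/4) ⊆ f(B(c, R)) ⊆ ℍ`. [folklore] -/
theorem norm_deriv_mul_le_four_mul_im (hR : 0 < R) (hf : DifferentiableOn ℂ f (ball c R))
    (hinj : InjOn f (ball c R)) (hH : MapsTo f (ball c R) upperHalfPlaneSet) :
    ‖deriv f c‖ * R / 4 ≤ (f c).im := by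
  by_contra hlt
  rw [not_le] at hlt
  have hc : 0 < (f c).im := hH (mem_ball_self hR)
  have hmem : ((f c).re : ℂ) ∈ ball (f c) (‖deriv f c‖ * R / 4) := by
    rw [mem_ball, dist_eq_norm]
    have : ((f c).re : ℂ) - f c = -((f c).im * I) := by
      apply Complex.ext <;> simp
    rw [this, norm_neg, norm_mul, Complex.norm_real, Complex.norm_I, mul_one, Real.norm_eq_abs,
      abs_of_pos hc]
    exact hlt
  obtain ⟨ζ, hζ, hζeq⟩ := ball_subset_image_ball hR hf hinj hmem
  have him : 0 < (f ζ).im := hH hζ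
  rw [hζeq, ofReal_im] at him
  exact lt_irrefl _ him

/-- **The derivative of a univalent map does not vanish** (from the lower distortion bound: if
`f'(c) = 0` then `f' ≡ 0` on the disc and `f` would be constant). [cite: PommerenkeBBCM1992, Thm. 1.3] -/
theorem norm_deriv_pos_of_injOn (hR : 0 < R) (hf : DifferentiableOn ℂ f (ball c R))
    (hinj : InjOn f (ball c R)) : 0 < ‖deriv f c‖ := by
  rcases (norm_nonneg (deriv f c)).eq_or_lt with h0 | h0
  · exfalso
    have h0' : deriv f c = 0 := norm_eq_zero.1 h0.symm
    have hzero : ∀ w' ∈ ball c R, deriv f w' = 0 := by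
      intro w' hw'
      obtain ⟨h1', -, -⟩ := AreaThm.distortion_ball hR hf hinj hw'
      rw [h0', norm_zero, zero_mul] at h1'
      exact norm_eq_zero.1 (le_antisymm h1' (norm_nonneg _))
    have hconst : ∀ w' ∈ ball c R, f w' = f c := fun w' hw' ↦
      (convex_ball c R).is_const_of_fderivWithin_eq_zero hf
        (fun x hx ↦ by
          rw [fderivWithin_eq_fderiv (isOpen_ball.uniqueDiffWithinAt hx)
            (hf.differentiableAt (isOpen_ball.mem_nhds hx))]
          ext1; simp [hzero x hx]) hw' (mem_ball_self hR)
    have hpt : c + (R / 2 : ℝ) ∈ ball c R := by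
      rw [mem_ball, dist_eq_norm, add_sub_cancel_left, Complex.norm_real, Real.norm_eq_abs,
        abs_of_pos (by positivity)]
      linarith
    have := hinj hpt (mem_ball_self hR) (hconst _ hpt)
    have hR0 : ((R / 2 : ℝ) : ℂ) = 0 := by simpa using this
    rw [Complex.ofReal_eq_zero] at hR0
    linarith
  · exact h0

/-- **Koebe distortion at a nearby point, logarithmic form**: for `f` univalent on `B(c, R)` and
`‖w - c‖ ≤ ρ R`, `ρ ≤ 1/2`: `|log |f'(w)| - log |f'(c)|| ≤ 7ρ`
(`log(1+r) - 3 log(1-r) ≤ 7r` and `log(1-r) - 3 log(1+r) ≥ -5r` for `r ≤ 1/2`).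
[cite: PommerenkeBBCM1992, Thm. 1.3] -/
theorem abs_log_norm_deriv_sub_le (hR : 0 < R) (hf : DifferentiableOn ℂ f (ball c R))
    (hinj : InjOn f (ball c R)) {w : ℂ} {ρ : ℝ} (hw : ‖w - c‖ ≤ ρ * R) (hρ : ρ ≤ 1 / 2) :
    |Real.log ‖deriv f w‖ - Real.log ‖deriv f c‖| ≤ 7 * ρ := by
  have hρ0 : 0 ≤ ρ := by
    by_contra h
    rw [not_le] at h
    have : ‖w - c‖ < 0 := hw.trans_lt (mul_neg_of_neg_of_pos h hR)
    exact absurd this (not_lt.2 (norm_nonneg _))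
  have hwb : w ∈ ball c R := by
    rw [mem_ball, dist_eq_norm]
    calc ‖w - c‖ ≤ ρ * R := hw
      _ < 1 * R := by gcongr; linarith
      _ = R := one_mul R
  obtain ⟨h1, h2, -⟩ := AreaThm.distortion_ball hR hf hinj hwb
  set r : ℝ := ‖w - c‖ / R with hr
  have hr0 : 0 ≤ r := by positivity
  have hrρ : r ≤ ρ := by rwa [hr, div_le_iff₀ hR]
  have hr2 : r ≤ 1 / 2 := hrρ.trans hρ
  have hdc : 0 < ‖deriv f c‖ := norm_deriv_pos_of_injOn hR hf hinj
  have hA : 0 < 1 - r := by linarith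
  have hB : 0 < 1 + r := by linarith
  have hdw : 0 < ‖deriv f w‖ := lt_of_lt_of_le (by positivity) h2
  have hl1 : Real.log (1 + r) ≤ r := by
    have := Real.log_le_sub_one_of_pos hB; linarith
  have hl2 : -(2 * r) ≤ Real.log (1 - r) := log_one_sub_ge hr0 hr2
  have hup : Real.log ‖deriv f w‖ - Real.log ‖deriv f c‖ ≤ 7 * r := by
    have h1' : ‖deriv f w‖ / ‖deriv f c‖ ≤ (1 + r) / (1 - r) ^ 3 := by
      rw [div_le_iff₀ hdc]; linarith [h1]
    have hlog := Real.log_le_log (by positivity) h1'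
    rw [Real.log_div hdw.ne' hdc.ne', Real.log_div hB.ne' (by positivity), Real.log_pow] at hlog
    push_cast at hlog
    linarith
  have hlo : -(5 * r) ≤ Real.log ‖deriv f w‖ - Real.log ‖deriv f c‖ := by
    have h2' : (1 - r) / (1 + r) ^ 3 ≤ ‖deriv f w‖ / ‖deriv f c‖ := by
      rw [le_div_iff₀ hdc]; linarith [h2]
    have hlog := Real.log_le_log (by positivity) h2'
    rw [Real.log_div hdw.ne' hdc.ne', Real.log_div hA.ne' (by positivity), Real.log_pow] at hlog
    push_cast at hlog
    linarith
  rw [abs_le]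
  constructor <;> nlinarith

/-- **Growth at a nearby point**: `‖f(w) - f(c)‖ ≤ 4 |f'(c)| ‖w - c‖` for `‖w - c‖ ≤ R/2`
(Pommerenke's (14): `|f(w) - f(c)| ≤ |f'(c)| R r/(1-r)²`, `r = ‖w - c‖/R ≤ 1/2`).
[cite: PommerenkeBBCM1992, Thm. 1.3] -/
theorem norm_sub_le_four_mul (hR : 0 < R) (hf : DifferentiableOn ℂ f (ball c R))
    (hinj : InjOn f (ball c R)) {w : ℂ} (hw : ‖w - c‖ ≤ R / 2) :
    ‖f w - f c‖ ≤ 4 * ‖deriv f c‖ * ‖w - c‖ := by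
  have hwb : w ∈ ball c R := by rw [mem_ball, dist_eq_norm]; linarith
  obtain ⟨-, -, h3⟩ := AreaThm.distortion_ball hR hf hinj hwb
  set r : ℝ := ‖w - c‖ / R with hr
  have hr0 : 0 ≤ r := by positivity
  have hr2 : r ≤ 1 / 2 := by rw [hr, div_le_iff₀ hR]; linarith
  have hq : r / (1 - r) ^ 2 ≤ 4 * r := by
    rw [div_le_iff₀ (by nlinarith)]
    nlinarith [mul_nonneg (mul_nonneg hr0 (by linarith : (0:ℝ) ≤ 1 - 2 * r))
      (by linarith : (0:ℝ) ≤ 3 - 2 * r)]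
  calc ‖f w - f c‖ ≤ ‖deriv f c‖ * R * (r / (1 - r) ^ 2) := h3
    _ ≤ ‖deriv f c‖ * R * (4 * r) := by gcongr
    _ = 4 * ‖deriv f c‖ * ‖w - c‖ := by rw [hr]; field_simp

/-! ### Maps into the upper half-plane: relative bounds at a nearby point -/

section IntoUpperHalfPlane

variable {w : ℂ} {ρ : ℝ} (hR : 0 < R) (hf : DifferentiableOn ℂ f (ball c R))
  (hinj : InjOn f (ball c R)) (hH : MapsTo f (ball c R) upperHalfPlaneSet)
  (hw : ‖w - c‖ ≤ ρ * R) (hρ : ρ ≤ 1 / 32)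

include hR hw hρ in
/-- The nearby point lies in the disc. [folklore] -/
theorem mem_ball_of_norm_sub_le : w ∈ ball c R := by
  rw [Metric.mem_ball, dist_eq_norm]
  calc ‖w - c‖ ≤ ρ * R := hw
    _ < 1 * R := by
        apply mul_lt_mul_of_pos_right _ hR
        linarith
    _ = R := one_mul R

include hR hw in
/-- `ρ ≥ 0` as soon as `‖w - c‖ ≤ ρR`. [folklore] -/
theorem nonneg_of_norm_sub_le : 0 ≤ ρ := by
  by_contra hρ'
  rw [not_le] at hρ'
  exact absurd (hw.trans_lt (mul_neg_of_neg_of_pos hρ' hR)) (not_lt.2 (norm_nonneg _))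

include hR hf hinj hH hw hρ

/-- **`‖f(w) - f(c)‖ ≤ 16 ρ Im f(c)`** (growth `≤ 4|f'(c)| ‖w - c‖ ≤ 4ρ |f'(c)| R` and Koebe
`|f'(c)| R ≤ 4 Im f(c)`). [folklore] -/
theorem norm_sub_le_mul_im : ‖f w - f c‖ ≤ 16 * ρ * (f c).im := by
  have h1 := norm_sub_le_four_mul hR hf hinj (w := w) (hw.trans (by nlinarith))
  have h2 := norm_deriv_mul_le_four_mul_im hR hf hinj hH
  have h0 := nonneg_of_norm_sub_le hR hw
  calc ‖f w - f c‖ ≤ 4 * ‖deriv f c‖ * ‖w - c‖ := h1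
    _ ≤ 4 * ‖deriv f c‖ * (ρ * R) := by gcongr
    _ = 4 * ρ * (‖deriv f c‖ * R) := by ring
    _ ≤ 4 * ρ * (4 * (f c).im) := by
        apply mul_le_mul_of_nonneg_left _ (by positivity)
        linarith
    _ = 16 * ρ * (f c).im := by ring

/-- `|Im f(w) - Im f(c)| ≤ 16 ρ Im f(c)`. [folklore] -/
theorem abs_im_sub_im_le_mul_im : |(f w).im - (f c).im| ≤ 16 * ρ * (f c).im := by
  have := abs_im_le_norm (f w - f c)
  rw [sub_im] at this
  exact this.trans (norm_sub_le_mul_im hR hf hinj hH hw hρ)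

/-- **`|log Im f(w) - log Im f(c)| ≤ 32 ρ`** (the ratio of heights lies in `[1 - 16ρ, 1 + 16ρ]`,
`16ρ ≤ 1/2`). [folklore] -/
theorem abs_log_im_sub_log_im_le : |Real.log (f w).im - Real.log (f c).im| ≤ 32 * ρ := by
  have hc : 0 < (f c).im := hH (mem_ball_self hR)
  have hw' : 0 < (f w).im := hH (mem_ball_of_norm_sub_le hR hw hρ)
  have h0 := nonneg_of_norm_sub_le hR hw
  have hb := abs_le.1 (abs_im_sub_im_le_mul_im hR hf hinj hH hw hρ)
  set x : ℝ := (f w).im / (f c).im with hx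
  have hxpos : 0 < x := div_pos hw' hc
  have hx1 : x ≤ 1 + 16 * ρ := by
    rw [hx, div_le_iff₀ hc]; nlinarith [hb.2]
  have hx2 : 1 - 16 * ρ ≤ x := by
    rw [hx, le_div_iff₀ hc]; nlinarith [hb.1]
  have hlog : Real.log (f w).im - Real.log (f c).im = Real.log x := by
    rw [hx, Real.log_div hw'.ne' hc.ne']
  rw [hlog, abs_le]
  constructor
  · have h1 := log_one_sub_ge (x := 16 * ρ) (by positivity) (by linarith)
    have h2 : Real.log (1 - 16 * ρ) ≤ Real.log x := Real.log_le_log (by linarith) hx2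
    linarith
  · have := Real.log_le_sub_one_of_pos hxpos
    linarith

/-- **Directions seen from a real base point agree to `O(ρ)`**: for real `x`, with
`Z_w = f(w) - x`, `Z_c = f(c) - x`: `|Re Z_w/|Z_w| - Re Z_c/|Z_c|| ≤ 32 ρ`
(`‖Z_w - Z_c‖ ≤ 16 ρ Im f(c) ≤ 16 ρ |Z_c|` and `‖a/|a| - b/|b|‖ ≤ 2‖a - b‖/‖b‖`). [folklore] -/
theorem abs_re_unit_sub_re_unit_le (x : ℝ) :
    |(f w - x).re / ‖f w - x‖ - (f c - x).re / ‖f c - x‖| ≤ 32 * ρ := by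
  have hc : 0 < (f c).im := hH (mem_ball_self hR)
  have hw' : 0 < (f w).im := hH (mem_ball_of_norm_sub_le hR hw hρ)
  have h0 := nonneg_of_norm_sub_le hR hw
  have hZc : f c - x ≠ 0 := by
    intro h0'; have := congrArg Complex.im h0'; simp at this; linarith
  have hZw : f w - x ≠ 0 := by
    intro h0'; have := congrArg Complex.im h0'; simp at this; linarith
  have hnorm : (f c).im ≤ ‖f c - x‖ := by
    have := abs_im_le_norm (f c - x)
    rw [sub_im, ofReal_im, sub_zero] at this
    exact (le_abs_self _).trans this
  have hdiff : ‖(f w - x) - (f c - x)‖ ≤ 16 * ρ * ‖f c - x‖ := by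
    rw [show (f w - x) - (f c - x) = f w - f c by ring]
    exact (norm_sub_le_mul_im hR hf hinj hH hw hρ).trans (by gcongr)
  have hpos : 0 < ‖f c - x‖ := norm_pos_iff.2 hZc
  have hu' : ‖(f w - x) / (‖f w - x‖ : ℂ) - (f c - x) / (‖f c - x‖ : ℂ)‖ ≤ 32 * ρ := by
    refine (norm_unit_sub_unit_le hZw hZc).trans ?_
    rw [div_le_iff₀ hpos]
    nlinarith [hdiff]
  rw [re_div_norm_eq_re_unit, re_div_norm_eq_re_unit, ← sub_re]
  exact (abs_re_le_norm _).trans hu'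

end IntoUpperHalfPlane

end Literature.Analysis.Complex

end
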